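import Literature.AlgebraicGeometry.HodgeTheory.AlgebraicMonodromyMumfordTate
import Literature.AlgebraicGeometry.HodgeTheory.BettiUniverseIsoTransport
import Literature.AlgebraicGeometry.HodgeTheory.DiagonalSymmetry
import HarnessLib

/-!
# Cyclic covers of the plane branched along smooth curves: the monodromy group is generated by
# reflections of finite order along one orbit of vanishing lines (Carlson–Toledo 1999, §§2, 3, 6, 7;
# named fact, with the Picard–Lefschetz package as a hypothesis structure)

Family `hodge`, layer `Literature/AlgebraicGeometry/HodgeTheory`. Sequel of `LefschetzMonodromy`
(Voisin II §3.2: Zariski's theorem `zariski_pi1_lineCompl_surjective`, the Lefschetz pencil package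
`LefschetzPencilSystem` / `nonempty_lefschetzPencilSystem`) for the OTHER classical family with a
Picard–Lefschetz theory: the universal family of `p`-fold cyclic covers `Y_f = {x₃^p = f(x₀,x₁,x₂)} ⊂ ℙ³`
of `ℙ²` branched along the smooth plane curves `V(f)` of degree `p` (`p` odd), whose local monodromies
are of FINITE order `p` (generalised Picard–Lefschetz formulas of Pham; Carlson–Toledo) instead of
transvections/reflections of order `∞`/`2`. Written by the literature-typing seat `littype-FH1-2` (cell
`hodge-nonav`) for the route `Summits/HodgeConjecture/HodgeConjecture/Theses/CyclicUnitaryPowers.lean`,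
crux K1 `VeryGeneralDeckCommutatorsInHg`, registered line `unitary-reflection-zariski`, whose
load-bearing geometric stub `stub_cyclicPencilEnvelope` is — clause by clause — the content of this
file (memo ROUTE-P3v14-g19 §3, "B3-a … B3-e"); the vocabulary is that stub's: the `ℚ`-Betti universe
`BettiUniverse` (`bettiCohomology`, `pull`, `cup`, `tr`, `pullEquiv`), families `Motives.fiberOver`,
`Motives.IsSmoothProjectiveFamily`, `IsCohomologicallyLocallyTrivialOn`, the rational monodromy group
`ratMonodromyGroup` of `AlgebraicMonodromyMumfordTate`, the model hypersurfaces
`Motives.SmoothHypersurface.hypersurface F` with their diagonal automorphisms `diagonalAut F ha`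
(`DiagonalSymmetry`).

## Source, verbatim (J. A. Carlson, D. Toledo, *Discriminant complements and kernels of monodromy
## representations*, Duke Math. J. 97 (1999) 621–648 [CarlsonToledo1999]; read in the arXiv text
## `paper:arxiv-alg-geom_9708002` (alg-geom/9708002), page files p0001–p0021; the arXiv text carries
## TeX labels instead of theorem numbers, which are quoted as printed)

* §2 (p0004): "let `k` be a divisor of `d` and consider the equation `F(a,x) = y^k + Σ a_L x^L = 0`
  (universalcyclic) […] defining a set `𝐘̂` in `(ℂ^{N+1} − {0}) × ℂ^{n+3}` […] The resulting universal
  family of cyclic covers `𝐘` is defined on `ℂ^{N+1} − {0}` and has smooth fibers over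
  `Ũ = ℂ^{N+1} − Δ̃`, where `Δ̃` is the pre-image of `Δ` [the discriminant]." (p0005): the monodromy
  takes values in the "group `G̃` of automorphisms of `H^{n+1}(Y_õ, ℂ)` which commute with the cyclic
  group of covering transformations (and which preserve the hyperplane class and the cup product)";
  "`H^{n+1}(Y,ℂ)_0 = ⊕_{μ ≠ 1} H(μ)`" (the primitive cohomology has no invariants under the covering
  group).
* §3 (p0006): "Assume that `S` is either `ℂ^{N+1} − {0}`, `N ≥ 1` or `ℙ^N`, so that `S` is simply
  connected and hence that `π₁(S − Δ)` is generated by meridians"; "A cycle orthogonal to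
  `V = V^n(X_o)` is invariant under all Picard-Lefschetz transformations, hence is invariant under the
  action of monodromy. Consequently its orthogonal complement `V^⊥` is the space of invariant cycles.
  The image of `H^n(𝐗̄)` in `H^n(X_o)` also consists of invariant cycles. By theorem 4.1.1 (or
  corollary (4.1.2)) of [DeHodgeTwo], this inclusion is an equality." (p0007): "When the discriminant
  locus is irreducible the argument of Zariski [Zar] or [DeWeOne], paragraph preceding Corollary 5.5,
  shows that the meridians of `π₁(S − Δ)` are mutually conjugate. […] Thus the vanishing cycles
  constitute a single orbit."; "Irreducibility of the discriminant locus for hypersurfaces is well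
  known […] the discriminant is the variety `𝒱̂` dual to `𝒱` [the Veronese variety]. Since the variety
  dual to an irreducible variety is also irreducible, it follows that the discriminant is irreducible."
* §6 (p0013–p0014), local equation `y^k + x_1² + ⋯ + x_{n+1}² = t` (kdoublept) of a generic
  degeneration (the branch locus acquires a node): "Thus `T` acts on the `(k−1)`-dimensional space of
  vanishing cycles as a transformation of order `k` […] the eigenvalues are the `k`-th roots of unity
  `μ ≠ 1`. Note that `T = σ_0` where `σ_0` is the generator for the automorphism group of the cyclic
  cover `y^k = t` given by `y ↦ ζy`"; "the space of vanishing cycles `V` for the singularity (kdoublept)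
  is `(k−1)`-dimensional and […] the local monodromy transformation is `T = σ_0⊗(−1)⊗⋯⊗(−1)` […] the
  cyclic automorphism `σ` of the universal family […] acts as `σ_0⊗(+1)⊗⋯⊗(+1)` on the vanishing
  homology […] Thus the eigenspaces of `σ` and `T` coincide, and their respective eigenvalues differ by
  the fixed sign `(−1)^{n+1}`"; "Now consider a cycle `x` in `H^{n+1}(Y_õ)`, and suppose that `k` is
  odd. Then the intersection form on the space `V` of local vanishing cycles for the degeneration
  (kdoublept) is nondegenerate. Consequently `H^{n+1}(Y_õ)` splits orthogonally as `V ⊕ V^⊥`. The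
  action on `H^{n+1}(Y_õ)` of the monodromy transformation `T` for the meridian corresponding to the
  degeneration (kdoublept) is given by (TVcxreflectionformula) on `V` and by the identity on `V^⊥`."
  **Proposition** (p0014): "Consider the family (universalcyclic) of `k`-fold cyclic covers of `ℙ^{n+1}`
  branched over a smooth hypersurface of degree `d`, where both `k` and `d` are odd. Let `T` be the
  monodromy corresponding to a generic degeneration of the branch locus, as in (kdoublept). Then `T`
  acts on the `i`-th eigenspace of the cyclic automorphism `σ` (defined by `y ↦ ζy` in
  (universalcyclic)) by a complex reflection with eigenvalue `λ_i = (−1)^{n+1} ζ^i`. Thus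
  `T(x) = x + ε_i (λ_i − 1) h(x,δ_i)δ_i` holds for all `x ∈ ℍ(i)`."
* §7 (p0015): "(reflectionconjugacy) `g⁻¹ s_δ g = s_{g⁻¹(δ)}`"; (p0016, last paragraph): "To apply the
  density theorem we need to show that the 'complex vanishing cycles' contain a basis for the vanishing
  cohomology and form a single orbit. […] If `γ' = κ⁻¹γκ` then […] `δ'_i = κ⁻¹.δ_i`, as required. By
  the same argument as used in §3, one sees that the complex vanishing cycles span `H(i)`."

## Rendering (real carriers of the tree; the case `n = 1`, `k = d = p` of the source)

The case needed by the consumer and stated here: `n = 1` (branch CURVES in `ℙ²`; the covers `Y` are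
SURFACES in `ℙ³`, so `n + 1 = 2` is even and, in the Proposition, `λ_i = (−1)² ζ^i = ζ^i`: ON THE
VANISHING SPACE THE LOCAL MONODROMY IS THE COVERING AUTOMORPHISM ITSELF, a transformation of order
`k`), and `k = d = p` odd, `3 ≤ p` (the source's "`d ≥ 3`"; primality is not needed).
`-- TODO(general form): k ∣ d, k and d odd, any n: T = (−1)^{n+1} σ on the vanishing space (CT99 §6).`
The classified forms are the NON-ZERO ternary forms `f` of degree `p` whose cover `X_F`, `F = x₃^p − f`,
is smooth projective (irreducible of dimension `2`) — equivalently `V(f) ⊂ ℙ²` is a smooth curve of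
degree `p`, the source's `Ũ`; `f = 0` has to be excluded explicitly because `X_{x₃^p} = V₊(x₃^p)_red`
is a plane, smooth projective of dimension `2`, but no member of the family (all three hypotheses
`f.IsHomogeneous p`, `f ≠ 0`, `IsSmoothProjective 2 X_F` are carried by every per-fibre field).
Everything is said over `ℚ` on `V = H²(Y_s(ℂ); ℚ) = bettiCohomology (fiberOver u s) 2`, as in the
consumer: the covering automorphism acts by a `τ : V ≃ₗ[ℚ] V` with `τ^p = 1`; the vanishing space of
the meridian `γ` is the `ℚ[τ]`-CYCLIC submodule `V_γ = cyclicSpan τ δ_γ = span_ℚ {τ^i δ_γ}` of one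
vanishing vector `δ_γ` (over `ℂ` it is the sum of the `k − 1` eigenlines `ℂ δ_i` of the Proposition;
"`T = σ_0`, the cyclic shift of the `A_{k−1}` basis `ξ_i − ξ_{i+1}`" makes it cyclic), it has dimension
`p − 1`, carries no `τ`-invariant vector ("eigenvalues the `k`-th roots of unity `μ ≠ 1`", i.e.
`(1 + τ + ⋯ + τ^{p−1}) δ_γ = 0`) and the cup-product form is non-degenerate on it; the local monodromy
"`σ` on `V`, identity on `V^⊥`" is the **cyclic reflection** `IsCyclicReflection B τ δ r` (`r = τ` on
`V_γ`, `r = id` on `V_γ^{⊥B}`). Which of `σ^*`, `(σ⁻¹)^*` the transported deck `τ` is, and the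
orientation of meridians, only change `T_γ` into `T_γ⁻¹`; the package records the convention-free
statement "the cyclic reflection along `V_γ` lies in the monodromy group `Γ`" (it is `T_γ` or `T_γ⁻¹`).

Why the spanning clause holds in `ℚ`-form (the source: "by the same argument as used in §3"): the
monodromy invariants are `(Σ_γ V_γ)^⊥` (each local monodromy fixes exactly `V_γ^⊥`, `V_γ` being
non-degenerate without `τ`-fixed vectors), and by Deligne's theorem of the fixed part (Hodge II 4.1.1,
the tree's `deligne_globalInvariantCycles`) applied to a general pencil `{x₃^p = f + t g}` — total
space `Bl_B ℙ³` with `H² = ℚH ⊕ ℚE`, `E|_Y = p·h` — they reduce to `ℚ·h`; hence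
`Σ_γ V_γ = h^⊥ ⊇ ker(1 + τ + ⋯ + τ^{p−1})`, while each `V_γ` lies in that kernel.

* `cyclicSpan τ δ`, `IsCyclicReflection B τ δ r` — definitions (bodies), with unfolding lemmas.
* `CyclicReflectionSystem Γ B τ p` — the ABSTRACT Picard–Lefschetz package of a point `s` of the
  family (hypothesis structure, the D-0014 idiom of `LefschetzPencilSystem`): the set `R` of vanishing
  vectors `δ_γ` (one cyclic generator of `V_γ` for each meridian `γ` based at `s`) with: `δ_γ ≠ 0`,
  `(Σ_{i<p} τ^i) δ_γ = 0`, `dim V_γ = p − 1`, `B|V_γ` non-degenerate (§6); the cyclic reflection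
  along `V_γ` lies in `Γ` (§6, Proposition); `Γ` is generated by the cyclic reflections along the
  `V_γ`, `δ_γ ∈ R` (§3: `π₁` of the complement of a hypersurface in affine/projective space is
  generated by meridians); the `V_γ` form ONE `Γ`-orbit (§3 and §7: the discriminant — the dual of the
  Veronese — is irreducible, so meridians are conjugate, and `V_{κ⁻¹γκ} = ρ(κ)⁻¹ V_γ`); and the `V_γ`
  SPAN the `τ`-anti-invariant part `ker (Σ_{i<p} τ^i)` (§7, last paragraph: "the complex vanishing
  cycles span `H(i)`" for every eigenvalue `ζ^i ≠ 1`, with §2: `H_0 = ⊕_{μ≠1} H(μ)`).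
* `cyclicCoverForm p f = x₃^p − f(x₀,x₁,x₂)` (`= CyclicCover.form p (−f)` of `CyclicCoverEigenHom` up
  to the sign of `f`; the consumer's spelling), `deckUnit p = (1,1,1,ζ_p)`, `ζ_p = exp(2πi/p)`, with
  `deckUnit_mem_diagonalStabilizer` (PROVED), so that `diagonalAut (cyclicCoverForm p f) _` is the deck
  transformation `x₃ ↦ ζ_p x₃` of the model `X_F`; `transportedTraceForm hX' e k` — the form
  `(x, y) ↦ tr_{X'}((e⁻¹)^* x ∪ (e⁻¹)^* y)` on `Hᵏ(Y)` transported along an isomorphism `e : Y ≅ X'`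
  (the expression of `BettiUniverseIsoTransport.exists_transportKit`), PROVED symmetric in even degree
  and non-degenerate in the middle degree.
* `CarlsonToledoFamily p` — the GEOMETRIC package: the universal family `u : 𝒴 ⟶ S` of smooth
  `p`-cyclic covers of `ℙ²` branched along smooth plane curves of degree `p` (§2 with `k = d = p`,
  `n = 1`; `S` = the open set of smooth members in the affine space `ℂ^{N+1}` of ternary forms of
  degree `p`, a smooth irreducible quasi-projective variety; Ehresmann: `R² u_* ℚ` is a local system),
  its classifying map `pt` on forms with the two properties that make `S(ℂ)` "the space of smooth
  ternary `p`-forms" (Zariski-closed subsets of `S(ℂ)` are cut out by polynomials in the coefficients;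
  every point is classified), isomorphisms `e_f : 𝒴_{pt f} ≅ X_F` of the fibres with the models
  `X_F = V(x₃^p − f) ⊂ ℙ³` (the fibre of (universalcyclic) over `a` IS `{y^p + f_a = 0}`), the
  covering automorphism `τ_f` of `H²(𝒴_{pt f}; ℚ)` (matched by `e_f` with `(diagonalAut F _)^*`), and
  at every classified point a `CyclicReflectionSystem` for the MONODROMY GROUP
  `Γ = ratMonodromyGroup u 2 _ (pt f)` of `R² u_* ℚ`, the transported trace form and `τ_f`.
* `nonempty_carlsonToledoFamily` — the NAMED FACT: for odd `p ≥ 3` such a family exists (§2, §3, §6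
  Proposition, §7 of the source, assembled).
* PROVED API (the consumer's clause shapes): `CyclicReflectionSystem.cyclicSpan_le_ker`,
  `.iSup_cyclicSpan_eq_ker`, `.exists_apply_mem` (one orbit, pointwise), `.mem_span_of_sum_eq_zero`
  (spanning, pointwise), `.mem_closure_of_mem`, `.apply_eq_self_of_forall_orthogonal` (§3: cycles
  orthogonal to the vanishing spaces are invariant), **`.forall_apply_eq_self_iff`** (§3 with
  Deligne: a vector is monodromy invariant iff it is `τ`-invariant — for the family, "the monodromy
  invariants of `H²(Y_s; ℚ)` are the pull-backs from `ℙ²`"); `CarlsonToledoFamily.alg` (the consumer's genericity clause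
  (ALG): a proper Zariski-closed subset of `S(ℂ)` is avoided by all smooth members off ONE polynomial
  condition on the coefficients which fails somewhere), `.finite` (fibre cohomology is
  finite-dimensional).

What is NOT here: the universal family as a CONSTRUCTED object of the tree (it is the base change of
the universal hyperplane section of the `p`-th Veronese embedding of `ℙ³` along `f ↦ x₃^p − f`; the
tree has `Motives.UniversalHyperplaneSection` but no Veronese embedding), whence the existential
packaging; the local analytic theory (Milnor fibres of `z^p = xy`, Sebastiani–Thom) behind §6, which
enters only through its printed conclusion; Carlson–Toledo's density theorem for unitary reflection
groups (§7, Theorem) and the main theorem on kernels (§1) — different files; the rank-one statement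
`H²(X_F; ℚ)^{σ} = ℚ·h` itself (transfer for the finite covering group; the consumer holds it as clause
(iii) of its `Deck`) — what IS proved here is `CyclicReflectionSystem.forall_apply_eq_self_iff`:
monodromy invariants = `τ`-invariants (§4 below), from the fields with `B` symmetric,
non-degenerate and `τ`-invariant and `τ^p = 1`.

## References

* [CarlsonToledo1999] J. A. Carlson, D. Toledo, Discriminant complements and kernels of monodromy
  representations, Duke Math. J. 97 (1999) 621–648; arXiv alg-geom/9708002 (held text
  `paper:arxiv-alg-geom_9708002`): §2 (p0004–p0005), §3 (p0006–p0007), §6 with its Proposition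
  (p0013–p0014), §7 (reflectionconjugacy) and last paragraph (p0015–p0016).
* [VoisinHodgeII2003] C. Voisin, Hodge Theory and Complex Algebraic Geometry II, CUP 2003, §3.2.2
  Thm. 3.22, Prop. 3.23 (Zariski's theorem and conjugacy of meridians; tree:
  `zariski_pi1_lineCompl_surjective`), Thm. 4.24 (global invariant cycles; tree:
  `deligne_globalInvariantCycles`).
* [DeligneHodgeII1971] P. Deligne, Théorie de Hodge II, Publ. Math. IHÉS 40 (1971), Thm. 4.1.1,
  Cor. 4.1.2.
* [Deligne1980] P. Deligne, La conjecture de Weil II, Publ. Math. IHÉS 52 (1980), §4.4 and Weil I §5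
  (conjugacy of vanishing cycles).
* F. Pham, Formules de Picard–Lefschetz généralisées et ramification des intégrales, Bull. SMF 93
  (1965) 333–367 (the local monodromy of `y^k + Σ x_i² = t`; CT99 ref. [Pham]).
-/

noncomputable section

open CategoryTheory AlgebraicGeometry
open Literature.AlgebraicTopology.SingularHomology
open Literature.AlgebraicGeometry.Motives

namespace Literature.AlgebraicGeometry.HodgeTheory

section HodgeTheory

/-! ### §1 Cyclic spans and cyclic reflections (linear algebra over `ℚ`) -/

section Algebra

variable {V : Type*} [AddCommGroup V] [Module ℚ V]

/-- The **cyclic span** `ℚ[τ]·δ = span_ℚ {τ^i δ | i ∈ ℕ}` of a vector `δ` under an automorphism `τ`: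
for the covering automorphism `τ = σ^*` of a cyclic cover and a vanishing vector `δ = δ_γ` this is
the VANISHING SPACE `V_γ` of the meridian `γ` ("the `(k−1)`-dimensional space of vanishing cycles",
on which "`T = σ_0`" acts by the cyclic shift of the basis `ξ_i − ξ_{i+1}`, so that one vanishing
cycle generates it as a `ℚ[σ]`-module). [cite: CarlsonToledo1999, §6 (held text p0013)] -/
def cyclicSpan (τ : V ≃ₗ[ℚ] V) (δ : V) : Submodule ℚ V :=
  Submodule.span ℚ (Set.range fun i : ℕ => (τ ^ i) δ)

/-- Unfolding of `cyclicSpan` (the consumer's spelling). [cite: CarlsonToledo1999, §6 (held text p0013)] -/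
theorem cyclicSpan_def (τ : V ≃ₗ[ℚ] V) (δ : V) :
    cyclicSpan τ δ = Submodule.span ℚ (Set.range fun i : ℕ => (τ ^ i) δ) := rfl

/-- `τ^i δ ∈ ℚ[τ]·δ`. [cite: CarlsonToledo1999, §6 (held text p0013)] -/
theorem pow_apply_mem_cyclicSpan (τ : V ≃ₗ[ℚ] V) (δ : V) (i : ℕ) : (τ ^ i) δ ∈ cyclicSpan τ δ :=
  Submodule.subset_span ⟨i, rfl⟩

/-- `δ ∈ ℚ[τ]·δ`. [cite: CarlsonToledo1999, §6 (held text p0013)] -/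
theorem self_mem_cyclicSpan (τ : V ≃ₗ[ℚ] V) (δ : V) : δ ∈ cyclicSpan τ δ := by
  simpa using pow_apply_mem_cyclicSpan τ δ 0

/-- `ℚ[τ]·δ` is stable under `τ`. [cite: CarlsonToledo1999, §6 (held text p0013)] -/
theorem apply_mem_cyclicSpan (τ : V ≃ₗ[ℚ] V) (δ : V) {x : V} (hx : x ∈ cyclicSpan τ δ) :
    τ x ∈ cyclicSpan τ δ := by
  induction hx using Submodule.span_induction with
  | mem y hy =>
    obtain ⟨i, rfl⟩ := hy
    have h : τ ((τ ^ i) δ) = (τ ^ (i + 1)) δ := by rw [pow_succ', LinearEquiv.mul_apply]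
    rw [h]
    exact pow_apply_mem_cyclicSpan τ δ (i + 1)
  | zero => rw [map_zero]; exact Submodule.zero_mem _
  | add y z _ _ hy hz => rw [map_add]; exact Submodule.add_mem _ hy hz
  | smul c y _ hy => rw [map_smul]; exact Submodule.smul_mem _ c hy

/-- `ℚ[τ]·δ` is stable under every power `τ^j`. [cite: CarlsonToledo1999, §6 (held text p0013)] -/
theorem pow_apply_mem_cyclicSpan_of_mem (τ : V ≃ₗ[ℚ] V) (δ : V) (j : ℕ) {x : V}
    (hx : x ∈ cyclicSpan τ δ) : (τ ^ j) x ∈ cyclicSpan τ δ := by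
  induction j with
  | zero => simpa using hx
  | succ j ih => rw [pow_succ', LinearEquiv.mul_apply]; exact apply_mem_cyclicSpan τ δ ih

/-- The powers of a linear automorphism, as linear maps, act as the powers of the automorphism.
[folklore] -/
private theorem toLinearMap_pow_apply (τ : V ≃ₗ[ℚ] V) (i : ℕ) (x : V) :
    ((τ : V →ₗ[ℚ] V) ^ i) x = (τ ^ i) x := by
  rw [Module.End.coe_pow, LinearEquiv.coe_pow]
  rfl

/-- `r` **is the cyclic reflection along `ℚ[τ]·δ`** (for the form `B`): `r = τ` on the cyclic span
`V_δ = ℚ[τ]·δ` and `r = id` on its `B`-orthogonal `V_δ^⊥` — the shape of the local monodromy of a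
generic degeneration of the branch locus acting on the cohomology of a cyclic cover: "given by
[`σ_0`, the covering automorphism] on `V` and by the identity on `V^⊥`"; on each eigenspace of `σ`
over `ℂ` it is a complex reflection `x ↦ x + ε_i(λ_i − 1)h(x,δ_i)δ_i`.
[cite: CarlsonToledo1999, §6 Proposition (held text p0014)] -/
def IsCyclicReflection (B : LinearMap.BilinForm ℚ V) (τ : V ≃ₗ[ℚ] V) (δ : V) (r : V ≃ₗ[ℚ] V) : Prop :=
  (∀ x ∈ cyclicSpan τ δ, r x = τ x) ∧ ∀ x, (∀ y ∈ cyclicSpan τ δ, B x y = 0) → r x = x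

/-- Unfolding of `IsCyclicReflection` (the consumer's spelling).
[cite: CarlsonToledo1999, §6 Proposition (held text p0014)] -/
theorem isCyclicReflection_iff (B : LinearMap.BilinForm ℚ V) (τ : V ≃ₗ[ℚ] V) (δ : V) (r : V ≃ₗ[ℚ] V) :
    IsCyclicReflection B τ δ r ↔
      (∀ x ∈ Submodule.span ℚ (Set.range fun i : ℕ => (τ ^ i) δ), r x = τ x) ∧
        ∀ x, (∀ y ∈ Submodule.span ℚ (Set.range fun i : ℕ => (τ ^ i) δ), B x y = 0) → r x = x :=
  Iff.rfl

/-- **The Picard–Lefschetz package of a point of a family of cyclic covers** (hypothesis structure;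
Carlson–Toledo §§3, 6, 7 for `k = d = p` odd and even-dimensional covers). On `V = H²(Y_s; ℚ)` with
its cup-product form `B`, covering automorphism `τ` and monodromy group `Γ ≤ GL(V)`: the set `R` of
VANISHING VECTORS `δ_γ` — for each meridian `γ` of the discriminant based at `s`, one `ℚ[τ]`-generator
of the vanishing space `V_γ = ℚ[τ]·δ_γ` of the `A_{p−1}`-degeneration it encircles — subject to the
printed properties: `δ_γ ≠ 0`; `V_γ` carries no `τ`-invariant vector ("the eigenvalues are the `k`-th
roots of unity `μ ≠ 1`"): `(1 + τ + ⋯ + τ^{p−1}) δ_γ = 0`; `dim V_γ = p − 1` ("`(k−1)`-dimensional");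
`B|V_γ` non-degenerate ("suppose that `k` is odd. Then the intersection form on the space `V` of local
vanishing cycles […] is nondegenerate"); the CYCLIC REFLECTION along `V_γ` — `τ` on `V_γ`, identity on
`V_γ^⊥`, i.e. the local monodromy `T_γ` of the Proposition (`λ_i = (−1)^{n+1}ζ^i = ζ^i` for surfaces)
or its inverse — lies in `Γ`; `Γ` is GENERATED by these cyclic reflections (§3: `π₁(S − Δ)` is
generated by meridians for `S` affine or projective space); the vanishing spaces form ONE `Γ`-ORBIT
(§3, §7: the discriminant is irreducible, meridians are conjugate, `V_{κ⁻¹γκ} = ρ(κ)⁻¹V_γ`); and they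
SPAN the `τ`-anti-invariant part `ker(1 + τ + ⋯ + τ^{p−1})` (§7, last paragraph: "the complex vanishing
cycles span `H(i)`", every `ζ^i ≠ 1`). [cite: CarlsonToledo1999, §3, §6 Proposition, §7 last paragraph (held text p0006–p0007, p0013–p0014, p0016)] -/
structure CyclicReflectionSystem (Γ : Subgroup (V ≃ₗ[ℚ] V)) (B : LinearMap.BilinForm ℚ V)
    (τ : V ≃ₗ[ℚ] V) (p : ℕ) where
  /-- The vanishing vectors `δ_γ`, one `ℚ[τ]`-generator of the vanishing space of each meridian `γ`. -/
  R : Set V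
  /-- Vanishing vectors are non-zero. -/
  ne_zero : ∀ δ ∈ R, δ ≠ 0
  /-- No `τ`-invariants on a vanishing space: `(Σ_{i<p} τ^i) δ_γ = 0` (§6: "the eigenvalues are the
  `k`-th roots of unity `μ ≠ 1`"). -/
  sum_pow_apply_eq_zero : ∀ δ ∈ R, ∑ i ∈ Finset.range p, (τ ^ i) δ = 0
  /-- The vanishing space `V_γ = ℚ[τ]·δ_γ` has dimension `p − 1` (§6: "`(k−1)`-dimensional"). -/
  finrank_cyclicSpan : ∀ δ ∈ R, Module.finrank ℚ (cyclicSpan τ δ) = p - 1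
  /-- `B` is non-degenerate on each vanishing space (§6: `k` odd, even-dimensional cover). -/
  eq_zero_of_forall_apply_eq_zero : ∀ δ ∈ R, ∀ x ∈ cyclicSpan τ δ,
    (∀ y ∈ cyclicSpan τ δ, B x y = 0) → x = 0
  /-- §6, Proposition: the cyclic reflection along `V_γ` (the local monodromy `T_γ` or its inverse)
  lies in the monodromy group. -/
  exists_mem_isCyclicReflection : ∀ δ ∈ R, ∃ r ∈ Γ, IsCyclicReflection B τ δ r
  /-- §3: the monodromy group is generated by the local monodromies of the meridians. -/
  le_closure : Γ ≤ Subgroup.closure {r | ∃ δ ∈ R, IsCyclicReflection B τ δ r}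
  /-- §3/§7: the vanishing spaces form a single `Γ`-orbit. -/
  exists_map_cyclicSpan_eq : ∀ δ ∈ R, ∀ δ' ∈ R, ∃ g ∈ Γ,
    (cyclicSpan τ δ').map (g : V →ₗ[ℚ] V) = cyclicSpan τ δ
  /-- §7, last paragraph: the vanishing spaces span the `τ`-anti-invariant part of `V`. -/
  mem_iSup_of_sum_pow_apply_eq_zero : ∀ x : V, ∑ i ∈ Finset.range p, (τ ^ i) x = 0 →
    x ∈ ⨆ δ ∈ R, cyclicSpan τ δ

namespace CyclicReflectionSystem

variable {Γ : Subgroup (V ≃ₗ[ℚ] V)} {B : LinearMap.BilinForm ℚ V} {τ : V ≃ₗ[ℚ] V} {p : ℕ}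
  (C : CyclicReflectionSystem Γ B τ p)

/-- Each vanishing space lies in the `τ`-anti-invariant part `ker (Σ_{i<p} τ^i)` (`τ` commutes with
`Σ τ^i`). [cite: CarlsonToledo1999, §6 (held text p0013)] -/
theorem cyclicSpan_le_ker {δ : V} (hδ : δ ∈ C.R) :
    cyclicSpan τ δ ≤ LinearMap.ker (∑ i ∈ Finset.range p, (τ : V →ₗ[ℚ] V) ^ i) := by
  rw [cyclicSpan, Submodule.span_le]
  rintro _ ⟨j, rfl⟩
  rw [SetLike.mem_coe, LinearMap.mem_ker, LinearMap.sum_apply]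
  have h : ∀ i ∈ Finset.range p, ((τ : V →ₗ[ℚ] V) ^ i) ((τ ^ j) δ) = (τ ^ j) ((τ ^ i) δ) := by
    intro i _
    rw [toLinearMap_pow_apply, ← LinearEquiv.mul_apply, ← LinearEquiv.mul_apply, ← pow_add, ← pow_add,
      add_comm]
  rw [Finset.sum_congr rfl h, ← map_sum, C.sum_pow_apply_eq_zero δ hδ, map_zero]

/-- **The vanishing spaces span exactly the anti-invariant part**: `⨆_γ V_γ = ker(1 + τ + ⋯ + τ^{p−1})`
(§7 last paragraph with §6). [cite: CarlsonToledo1999, §7 last paragraph (held text p0016)] -/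
theorem iSup_cyclicSpan_eq_ker :
    ⨆ δ ∈ C.R, cyclicSpan τ δ = LinearMap.ker (∑ i ∈ Finset.range p, (τ : V →ₗ[ℚ] V) ^ i) := by
  refine le_antisymm (iSup₂_le fun δ hδ ↦ C.cyclicSpan_le_ker hδ) fun x hx ↦ ?_
  refine C.mem_iSup_of_sum_pow_apply_eq_zero x ?_
  rw [LinearMap.mem_ker, LinearMap.sum_apply] at hx
  rw [← hx]
  exact Finset.sum_congr rfl fun i _ ↦ (toLinearMap_pow_apply τ i x).symm

/-- The supremum of the vanishing spaces is the span of all the `τ^i δ`, `δ ∈ R` (the consumer's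
spelling of "the span of the vanishing cycles"). [cite: CarlsonToledo1999, §3 (held text p0006)] -/
theorem iSup_cyclicSpan_eq_span :
    ⨆ δ ∈ C.R, cyclicSpan τ δ = Submodule.span ℚ {y | ∃ δ ∈ C.R, ∃ i : ℕ, y = (τ ^ i) δ} := by
  refine le_antisymm (iSup₂_le fun δ hδ ↦ ?_) (Submodule.span_le.mpr ?_)
  · rw [cyclicSpan, Submodule.span_le]
    rintro _ ⟨i, rfl⟩
    exact Submodule.subset_span ⟨δ, hδ, i, rfl⟩
  · rintro _ ⟨δ, hδ, i, rfl⟩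
    exact Submodule.mem_iSup_of_mem δ (Submodule.mem_iSup_of_mem hδ (pow_apply_mem_cyclicSpan τ δ i))

/-- **Spanning, pointwise** (the consumer's clause): a `τ`-anti-invariant vector is a linear
combination of the `τ^i δ`, `δ ∈ R`. [cite: CarlsonToledo1999, §7 last paragraph (held text p0016)] -/
theorem mem_span_of_sum_pow_apply_eq_zero (x : V) (hx : ∑ i ∈ Finset.range p, (τ ^ i) x = 0) :
    x ∈ Submodule.span ℚ {y | ∃ δ ∈ C.R, ∃ i : ℕ, y = (τ ^ i) δ} := by
  rw [← C.iSup_cyclicSpan_eq_span]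
  exact C.mem_iSup_of_sum_pow_apply_eq_zero x hx

/-- **One orbit, pointwise** (the consumer's clause): for vanishing vectors `δ, δ'` some monodromy
transformation carries `δ'` into the vanishing space of `δ`. [cite: CarlsonToledo1999, §3 and §7 (held text p0007, p0016)] -/
theorem exists_apply_mem_cyclicSpan {δ δ' : V} (hδ : δ ∈ C.R) (hδ' : δ' ∈ C.R) :
    ∃ g ∈ Γ, g δ' ∈ cyclicSpan τ δ := by
  obtain ⟨g, hg, hmap⟩ := C.exists_map_cyclicSpan_eq δ hδ δ' hδ'
  refine ⟨g, hg, ?_⟩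
  rw [← hmap]
  exact Submodule.mem_map_of_mem (self_mem_cyclicSpan τ δ')

/-- The cyclic reflections along the vanishing spaces lie in `Γ` and generate it: the closure of the
set of cyclic reflections along the `δ ∈ R` CONTAINS `Γ` (restating the field) — together with
`exists_mem_isCyclicReflection` this is "`Γ` is the group generated by the local monodromies".
[cite: CarlsonToledo1999, §3 (held text p0006)] -/
theorem mem_closure_of_mem {g : V ≃ₗ[ℚ] V} (hg : g ∈ Γ) :
    g ∈ Subgroup.closure {r | ∃ δ ∈ C.R, IsCyclicReflection B τ δ r} :=
  C.le_closure hg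

/-- A vector `B`-orthogonal to all the vanishing spaces is fixed by every cyclic reflection along
them, hence by the whole monodromy group ("A cycle orthogonal to `V` is invariant under all
Picard-Lefschetz transformations, hence is invariant under the action of monodromy").
[cite: CarlsonToledo1999, §3 (held text p0006)] -/
theorem apply_eq_self_of_forall_orthogonal {x : V}
    (hx : ∀ δ ∈ C.R, ∀ y ∈ cyclicSpan τ δ, B x y = 0) {g : V ≃ₗ[ℚ] V} (hg : g ∈ Γ) : g x = x := by
  have key : ∀ r ∈ Subgroup.closure {r | ∃ δ ∈ C.R, IsCyclicReflection B τ δ r}, r x = x := by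
    intro r hr
    induction hr using Subgroup.closure_induction with
    | mem r hr =>
      obtain ⟨δ, hδ, hr⟩ := hr
      exact hr.2 x (hx δ hδ)
    | one => rfl
    | mul r r' _ _ hr hr' => rw [LinearEquiv.mul_apply, hr', hr]
    | inv r _ hr =>
      have h : r⁻¹ (r x) = x := by rw [← LinearEquiv.mul_apply, inv_mul_cancel]; rfl
      rw [hr] at h
      exact h
  exact key g (C.le_closure hg)

/-! #### Monodromy invariants versus `τ`-invariants (§3: "`V^⊥` is the space of invariant cycles") -/

section Invariants

/-- The norm element `Φ = 1 + τ + ⋯ + τ^{p−1}` acts on vectors as `Σ_{i<p} τ^i`. [folklore] -/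
private theorem normSum_apply (x : V) :
    (∑ i ∈ Finset.range p, (τ : V →ₗ[ℚ] V) ^ i) x = ∑ i ∈ Finset.range p, (τ ^ i) x := by
  rw [LinearMap.sum_apply]
  exact Finset.sum_congr rfl fun i _ ↦ toLinearMap_pow_apply τ i x

/-- `τ Φ = Φ` when `τ^p = 1`: the values of `Φ` are `τ`-invariant. [folklore] -/
private theorem apply_sum_pow_apply (hp : τ ^ p = 1) (x : V) :
    τ (∑ i ∈ Finset.range p, (τ ^ i) x) = ∑ i ∈ Finset.range p, (τ ^ i) x := by
  rw [map_sum]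
  have h : ∀ i ∈ Finset.range p, τ ((τ ^ i) x) = (τ ^ (i + 1)) x := fun i _ ↦ by
    rw [pow_succ', LinearEquiv.mul_apply]
  rw [Finset.sum_congr rfl h]
  have h' := Finset.sum_range_succ' (fun i ↦ (τ ^ i) x) p
  rw [Finset.sum_range_succ, hp, pow_zero] at h'
  exact add_right_cancel h'.symm

/-- On a `τ`-fixed vector `Φ` acts as multiplication by `p`. [folklore] -/
private theorem sum_pow_apply_of_apply_eq (x : V) (hx : τ x = x) :
    ∑ i ∈ Finset.range p, (τ ^ i) x = (p : ℚ) • x := by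
  have h' : ∀ i : ℕ, (τ ^ i) x = x := fun i ↦ by
    induction i with
    | zero => rw [pow_zero]; rfl
    | succ i ih => rw [pow_succ, LinearEquiv.mul_apply, hx, ih]
  rw [Finset.sum_congr rfl fun i _ ↦ h' i, Finset.sum_const, Finset.card_range, Nat.cast_smul_eq_nsmul]

/-- A `τ`-isometry is a `τ^i`-isometry. [folklore] -/
private theorem apply_pow_apply_pow (hBτ : ∀ x y, B (τ x) (τ y) = B x y) (i : ℕ) (x y : V) :
    B ((τ ^ i) x) ((τ ^ i) y) = B x y := by
  induction i with
  | zero => rw [pow_zero]; rfl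
  | succ i ih => rw [pow_succ', LinearEquiv.mul_apply, LinearEquiv.mul_apply, hBτ, ih]

/-- `τ`-invariant vectors are `B`-orthogonal to the `τ`-anti-invariant part `ker Φ` (for a
`τ`-invariant form over `ℚ`: `p·B(u,v) = B(u, Φ v) = 0`). [folklore] -/
private theorem apply_apply_eq_zero_of_fixed (hBτ : ∀ x y, B (τ x) (τ y) = B x y) (hp0 : p ≠ 0)
    {u v : V} (hu : τ u = u) (hv : ∑ i ∈ Finset.range p, (τ ^ i) v = 0) : B u v = 0 := by
  have hui : ∀ i : ℕ, (τ ^ i) u = u := fun i ↦ by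
    induction i with
    | zero => rw [pow_zero]; rfl
    | succ i ih => rw [pow_succ, LinearEquiv.mul_apply, hu, ih]
  have hi : ∀ i ∈ Finset.range p, B u ((τ ^ i) v) = B u v := by
    intro i _
    conv_lhs => rw [← hui i]
    exact apply_pow_apply_pow hBτ i u v
  have h : (p : ℚ) * B u v = B u (∑ i ∈ Finset.range p, (τ ^ i) v) := by
    rw [map_sum, Finset.sum_congr rfl hi, Finset.sum_const, Finset.card_range, nsmul_eq_mul]
  rw [hv, map_zero] at h
  exact (mul_eq_zero.mp h).resolve_left (Nat.cast_ne_zero.mpr hp0)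

include C in
/-- **`τ`-invariant vectors are monodromy invariant**: a `τ`-fixed vector is `B`-orthogonal to every
vanishing space (`V_γ ⊆ ker Φ`), hence fixed by every cyclic reflection and by `Γ` — for a cyclic
cover: the pull-backs from `ℙ²` are monodromy invariant. Hypotheses: `B` is `τ`-invariant and
`p ≠ 0`. [cite: CarlsonToledo1999, §3 (held text p0006)] -/
theorem apply_eq_self_of_apply_eq_self (hBτ : ∀ x y, B (τ x) (τ y) = B x y) (hp0 : p ≠ 0) {x : V}
    (hx : τ x = x) {g : V ≃ₗ[ℚ] V} (hg : g ∈ Γ) : g x = x := by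
  refine C.apply_eq_self_of_forall_orthogonal (fun δ hδ y hy ↦ ?_) hg
  have hy' : ∑ i ∈ Finset.range p, (τ ^ i) y = 0 := by
    rw [← normSum_apply]
    exact LinearMap.mem_ker.mp (C.cyclicSpan_le_ker hδ hy)
  exact apply_apply_eq_zero_of_fixed hBτ hp0 hx hy'

include C in
/-- **Monodromy invariants are `τ`-invariant** ("`V^⊥` is the space of invariant cycles", read
backwards: a `Γ`-fixed vector is orthogonal to every vanishing space, hence to their span
`ker Φ`, hence lies in `(ker Φ)^⊥ = V^τ`). Hypotheses: `V` finite-dimensional, `B` symmetric,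
non-degenerate and `τ`-invariant, `τ^p = 1`, `p ≠ 0`. For the family of cyclic covers this is
"the monodromy invariants of `H²(Y_s; ℚ)` are the covering-group invariants `= H²(ℙ²; ℚ) = ℚ·h`".
[cite: CarlsonToledo1999, §3 and §7 last paragraph (held text p0006, p0016)] -/
theorem apply_eq_self_of_forall_apply_eq_self [Module.Finite ℚ V] (hB : B.IsSymm)
    (hBnd : B.Nondegenerate) (hBτ : ∀ x y, B (τ x) (τ y) = B x y) (hp : τ ^ p = 1) (hp0 : p ≠ 0)
    {x : V} (hx : ∀ g ∈ Γ, g x = x) : τ x = x := by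
  have hrefl : B.IsRefl := hB.isRefl
  have hBsymm : ∀ u v : V, B u v = B v u := fun u v ↦ by simpa using hB.eq u v
  -- the decomposition `x = x₁ + x₀`, `x₁ = p⁻¹ Φ x ∈ V^τ`, `Φ x₀ = 0`
  set x₁ : V := (p : ℚ)⁻¹ • ∑ i ∈ Finset.range p, (τ ^ i) x with hx₁
  have hx₁τ : τ x₁ = x₁ := by rw [hx₁, map_smul, apply_sum_pow_apply hp]
  set x₀ : V := x - x₁ with hx₀
  have hpQ : (p : ℚ) ≠ 0 := Nat.cast_ne_zero.mpr hp0
  have hx₀Φ : ∑ i ∈ Finset.range p, (τ ^ i) x₀ = 0 := by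
    have h1 : ∑ i ∈ Finset.range p, (τ ^ i) x₁ = (p : ℚ) • x₁ := sum_pow_apply_of_apply_eq x₁ hx₁τ
    simp only [hx₀, map_sub, Finset.sum_sub_distrib, h1]
    rw [hx₁, smul_smul, mul_inv_cancel₀ hpQ, one_smul, sub_self]
  -- every cyclic reflection fixes `x` and `x₁`, hence `x₀`; so `x₀ ⊥ V_γ` for all `γ`
  have horth : ∀ δ ∈ C.R, ∀ y ∈ cyclicSpan τ δ, B x₀ y = 0 := by
    intro δ hδ
    obtain ⟨r, hrΓ, hr⟩ := C.exists_mem_isCyclicReflection δ hδ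
    -- `B|V_δ` non-degenerate ⇒ `V = V_δ ⊕ V_δ^⊥`
    have hnd : (B.restrict (cyclicSpan τ δ)).Nondegenerate := by
      refine (LinearMap.IsRefl.nondegenerate_iff_separatingLeft fun a b hab ↦ ?_).mpr ?_
      · change B b.1 a.1 = 0
        rw [hBsymm]
        exact hab
      · intro a ha
        exact Subtype.ext (C.eq_zero_of_forall_apply_eq_zero δ hδ a.1 a.2 fun y hy ↦ ha ⟨y, hy⟩)
    have hcompl := LinearMap.BilinForm.isCompl_orthogonal_of_restrict_nondegenerate hrefl hnd
    obtain ⟨a, ha, b, hb, hab⟩ := Submodule.mem_sup.mp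
      (show x₀ ∈ cyclicSpan τ δ ⊔ B.orthogonal (cyclicSpan τ δ) by rw [hcompl.sup_eq_top]; trivial)
    rw [LinearMap.BilinForm.mem_orthogonal_iff] at hb
    have hb' : ∀ y ∈ cyclicSpan τ δ, B b y = 0 := fun y hy ↦ by
      rw [hBsymm]; exact hb y hy
    -- `r x₀ = x₀`: `r x = x` (monodromy invariance) and `r x₁ = x₁` (`x₁ ∈ V^τ ⊥ V_δ`)
    have hx₁orth : ∀ y ∈ cyclicSpan τ δ, B x₁ y = 0 := fun y hy ↦ by
      have hy' : ∑ i ∈ Finset.range p, (τ ^ i) y = 0 := by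
        rw [← normSum_apply]
        exact LinearMap.mem_ker.mp (C.cyclicSpan_le_ker hδ hy)
      exact apply_apply_eq_zero_of_fixed hBτ hp0 hx₁τ hy'
    have hrx₀ : r x₀ = x₀ := by
      rw [hx₀, map_sub, hx r hrΓ, hr.2 x₁ hx₁orth]
    -- the `V_δ`-component `a` of `x₀` is `τ`-fixed and anti-invariant, hence `0`
    have hra : r a = τ a := hr.1 a ha
    have hrb : r b = b := hr.2 b hb'
    have hτa : τ a = a := by
      have h := hrx₀
      rw [← hab, map_add, hra, hrb] at h
      exact add_right_cancel h
    have haΦ : ∑ i ∈ Finset.range p, (τ ^ i) a = 0 := by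
      rw [← normSum_apply]
      exact LinearMap.mem_ker.mp (C.cyclicSpan_le_ker hδ ha)
    have ha0 : a = 0 := by
      have h := sum_pow_apply_of_apply_eq (p := p) a hτa
      rw [haΦ] at h
      exact (smul_eq_zero.mp h.symm).resolve_left hpQ
    rw [ha0, zero_add] at hab
    rw [← hab]
    exact hb'
  -- `x₀ ⊥ ker Φ` and `x₀ ⊥ V^τ`-part of every vector, so `x₀ ⊥ V`, so `x₀ = 0`
  have hx₀orthV : ∀ w : V, B x₀ w = 0 := by
    intro w
    set w₁ : V := (p : ℚ)⁻¹ • ∑ i ∈ Finset.range p, (τ ^ i) w with hw₁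
    have hw₁τ : τ w₁ = w₁ := by rw [hw₁, map_smul, apply_sum_pow_apply hp]
    have hw₀Φ : ∑ i ∈ Finset.range p, (τ ^ i) (w - w₁) = 0 := by
      have h1 : ∑ i ∈ Finset.range p, (τ ^ i) w₁ = (p : ℚ) • w₁ := sum_pow_apply_of_apply_eq w₁ hw₁τ
      simp only [map_sub, Finset.sum_sub_distrib, h1]
      rw [hw₁, smul_smul, mul_inv_cancel₀ hpQ, one_smul, sub_self]
    have hw₀mem : w - w₁ ∈ Submodule.span ℚ {y | ∃ δ ∈ C.R, ∃ i : ℕ, y = (τ ^ i) δ} :=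
      C.mem_span_of_sum_pow_apply_eq_zero _ hw₀Φ
    have hspan : ∀ v ∈ Submodule.span ℚ {y | ∃ δ ∈ C.R, ∃ i : ℕ, y = (τ ^ i) δ}, B x₀ v = 0 := by
      intro v hv
      induction hv using Submodule.span_induction with
      | mem y hy =>
        obtain ⟨δ, hδ, i, rfl⟩ := hy
        exact horth δ hδ _ (pow_apply_mem_cyclicSpan τ δ i)
      | zero => exact map_zero _
      | add y z _ _ hy hz => rw [map_add, hy, hz, add_zero]
      | smul c y _ hy => rw [map_smul, hy, smul_zero]
    have hB0 : B x₀ (w - w₁) = 0 := hspan _ hw₀mem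
    have hB1 : B x₀ w₁ = 0 := by
      rw [hBsymm]
      exact apply_apply_eq_zero_of_fixed hBτ hp0 hw₁τ hx₀Φ
    have hw : w = (w - w₁) + w₁ := (sub_add_cancel w w₁).symm
    rw [hw, map_add, hB0, hB1, add_zero]
  have hx₀0 : x₀ = 0 := hBnd.1 x₀ hx₀orthV
  have hxx₁ : x = x₁ := by rwa [hx₀, sub_eq_zero] at hx₀0
  rw [hxx₁]
  exact hx₁τ

include C in
/-- **Monodromy invariants = covering-group invariants** (the two previous statements):
`(∀ g ∈ Γ, g x = x) ↔ τ x = x`, under the hypotheses of `apply_eq_self_of_forall_apply_eq_self`.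
For the universal family of `p`-cyclic covers of `ℙ²` this identifies `H²(Y_s; ℚ)^Γ` with
`H²(Y_s; ℚ)^{σ} = H²(ℙ²; ℚ)`, the line of the hyperplane class (CT99 §3 with Deligne, Hodge II
4.1.1; §2: "`H^{n+1}(Y,ℂ)_0 = ⊕_{μ≠1} H(μ)`").
[cite: CarlsonToledo1999, §2, §3 (held text p0005–p0006)] -/
theorem forall_apply_eq_self_iff [Module.Finite ℚ V] (hB : B.IsSymm) (hBnd : B.Nondegenerate)
    (hBτ : ∀ x y, B (τ x) (τ y) = B x y) (hp : τ ^ p = 1) (hp0 : p ≠ 0) (x : V) :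
    (∀ g ∈ Γ, g x = x) ↔ τ x = x :=
  ⟨fun hx ↦ C.apply_eq_self_of_forall_apply_eq_self hB hBnd hBτ hp hp0 hx,
    fun hx _ hg ↦ C.apply_eq_self_of_apply_eq_self hBτ hp0 hx hg⟩

end Invariants

end CyclicReflectionSystem

end Algebra

/-! ### §2 The models `X_F = V(x₃^p − f) ⊂ ℙ³`, their deck transformation, transported forms -/

section Models

/-- The **cyclic cover form** `F = x₃^p − f(x₀, x₁, x₂)` in four variables: `X_F = V₊(F) ⊂ ℙ³` is the
`p`-fold cyclic cover of `ℙ²` branched along the plane curve `V(f)` — the fibre `{y^k + Σ a_L x^L = 0}`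
of the universal family of cyclic covers (universalcyclic) with `k = d = p`, `n = 1`, up to the sign of
`f` (the consumer's spelling; `CyclicCover.form p (−f)` of `CyclicCoverEigenHom`).
[cite: CarlsonToledo1999, §2 (universalcyclic) (held text p0004)] -/
def cyclicCoverForm (p : ℕ) (f : MvPolynomial (Fin 3) ℂ) : MvPolynomial (Fin 4) ℂ :=
  MvPolynomial.X (Fin.last 3) ^ p - MvPolynomial.rename Fin.castSucc f

/-- Unfolding of `cyclicCoverForm`. [cite: CarlsonToledo1999, §2 (universalcyclic) (held text p0004)] -/
theorem cyclicCoverForm_def (p : ℕ) (f : MvPolynomial (Fin 3) ℂ) :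
    cyclicCoverForm p f = MvPolynomial.X (Fin.last 3) ^ p - MvPolynomial.rename Fin.castSucc f := rfl

/-- The **deck unit** `a = (1, 1, 1, ζ_p) ∈ (ℂˣ)⁴`, `ζ_p = exp(2πi/p)`: the diagonal scaling
`x₃ ↦ ζ_p x₃` generating the covering group of `X_F → ℙ²` ("the cyclic action on the universal family
(universalcyclic) be given by `y ∘ σ = ζ y`", `ζ = e^{2πi/k}`; the consumer's spelling).
[cite: CarlsonToledo1999, §5 (held text p0011)] -/
def deckUnit (p : ℕ) : Fin 4 → ℂˣ := fun i =>
  if i = Fin.last 3 then Units.mk0 (Complex.exp (2 * (Real.pi : ℂ) * Complex.I / (p : ℂ)))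
    (Complex.exp_ne_zero _) else 1

/-- Unfolding of `deckUnit` (the consumer's spelling). [cite: CarlsonToledo1999, §5 (held text p0011)] -/
theorem deckUnit_def (p : ℕ) : deckUnit p = fun i : Fin 4 =>
    if i = Fin.last 3 then Units.mk0 (Complex.exp (2 * (Real.pi : ℂ) * Complex.I / (p : ℂ)))
      (Complex.exp_ne_zero _) else 1 := rfl

/-- `ζ_p^p = 1` for `ζ_p = exp(2πi/p)`, `p ≠ 0`. [folklore] -/
private theorem exp_two_pi_I_div_pow (p : ℕ) (hp : p ≠ 0) :
    Complex.exp (2 * (Real.pi : ℂ) * Complex.I / (p : ℂ)) ^ p = 1 := by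
  rw [← Complex.exp_nat_mul, mul_div_cancel₀ _ (Nat.cast_ne_zero.mpr hp), Complex.exp_two_pi_mul_I]

/-- The deck unit is `ζ_p` in the last coordinate. [folklore] -/
private theorem deckUnit_last (p : ℕ) :
    (deckUnit p (Fin.last 3) : ℂ) = Complex.exp (2 * (Real.pi : ℂ) * Complex.I / (p : ℂ)) := by
  simp [deckUnit]

/-- The deck unit is `1` in the first three coordinates. [folklore] -/
private theorem deckUnit_castSucc (p : ℕ) (i : Fin 3) : (deckUnit p (Fin.castSucc i) : ℂ) = 1 := by
  have h : Fin.castSucc i ≠ Fin.last 3 := (Fin.castSucc_lt_last i).ne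
  unfold deckUnit
  rw [if_neg h, Units.val_one]

/-- The deck scaling fixes the pulled-back ternary form: `σ_a(f(x₀,x₁,x₂)) = f(x₀,x₁,x₂)`. [folklore] -/
private theorem aeval_diagonalSubst_deckUnit_rename (p : ℕ) (f : MvPolynomial (Fin 3) ℂ) :
    MvPolynomial.aeval (diagonalSubst (deckUnit p)) (MvPolynomial.rename Fin.castSucc f) =
      MvPolynomial.rename Fin.castSucc f := by
  have h : (diagonalSubst (deckUnit p) ∘ Fin.castSucc : Fin 3 → MvPolynomial (Fin 4) ℂ) =
      MvPolynomial.X ∘ Fin.castSucc := by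
    funext i
    rw [Function.comp_apply, Function.comp_apply, diagonalSubst_apply, deckUnit_castSucc,
      MvPolynomial.C_1, one_mul]
  rw [MvPolynomial.aeval_rename, h, MvPolynomial.rename_eq_aeval]

/-- The deck scaling multiplies `x₃` by `ζ_p`: `σ_a(x₃) = ζ_p x₃`. [folklore] -/
private theorem aeval_diagonalSubst_deckUnit_X_last (p : ℕ) :
    MvPolynomial.aeval (diagonalSubst (deckUnit p)) (MvPolynomial.X (Fin.last 3) : MvPolynomial (Fin 4) ℂ) =
      MvPolynomial.C (Complex.exp (2 * (Real.pi : ℂ) * Complex.I / (p : ℂ))) * MvPolynomial.X (Fin.last 3) := by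
  rw [MvPolynomial.aeval_X, diagonalSubst_apply, deckUnit_last]

/-- **The deck unit stabilises the cyclic cover form**: `(ζ_p x₃)^p − f = x₃^p − f` (`ζ_p^p = 1`),
so `diagonalAut (cyclicCoverForm p f) _ : X_F ⟶ X_F` is the deck transformation `x₃ ↦ ζ_p x₃` of the
covering `X_F → ℙ²`. [cite: CarlsonToledo1999, §5 (held text p0011)] -/
theorem deckUnit_mem_diagonalStabilizer {p : ℕ} (hp : p ≠ 0) (f : MvPolynomial (Fin 3) ℂ) :
    deckUnit p ∈ diagonalStabilizer (cyclicCoverForm p f) := by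
  rw [mem_diagonalStabilizer_iff, cyclicCoverForm, map_sub, map_pow, aeval_diagonalSubst_deckUnit_X_last,
    aeval_diagonalSubst_deckUnit_rename, mul_pow, ← MvPolynomial.C_pow, exp_two_pi_I_div_pow p hp,
    MvPolynomial.C_1, one_mul]

variable {m k : ℕ} {Y X' : SchemeOver ℂ}

/-- **The trace form transported along an isomorphism of varieties**: for `e : Y ≅ X'` over `ℂ` with
`X'` smooth projective of dimension `m`, the bilinear form `(x, y) ↦ tr_{X'}((e⁻¹)^* x ∪ (e⁻¹)^* y)`
on `Hᵏ(Y(ℂ); ℚ)` (`φ = BettiUniverse.pullEquiv e k = (e⁻¹)^*`; the expression packaged in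
`BettiUniverse.exists_transportKit`): "the cup product" of the fibre, read on the model.
[cite: CarlsonToledo1999, §2 (held text p0005)] -/
def transportedTraceForm (hX' : IsSmoothProjective m X') (e : Y ≅ X') (k : ℕ) :
    LinearMap.BilinForm ℚ (bettiCohomology Y k) :=
  LinearMap.BilinForm.comp ((BettiUniverse.cup X' k k).compr₂ (BettiUniverse.tr hX' (k + k)))
    (BettiUniverse.pullEquiv e k).toLinearMap (BettiUniverse.pullEquiv e k).toLinearMap

/-- `transportedTraceForm hX' e k x y = tr_{X'}(φ x ∪ φ y)`, `φ = pullEquiv e k` (unfolding; the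
consumer's clause `B x y = tr hXF (2 + 2) (cup _ 2 2 (φ x) (φ y))`). [cite: CarlsonToledo1999, §2 (held text p0005)] -/
theorem transportedTraceForm_apply (hX' : IsSmoothProjective m X') (e : Y ≅ X') (k : ℕ)
    (x y : bettiCohomology Y k) :
    transportedTraceForm hX' e k x y = BettiUniverse.tr hX' (k + k)
      (BettiUniverse.cup X' k k (BettiUniverse.pullEquiv e k x) (BettiUniverse.pullEquiv e k y)) :=
  rfl

/-- The transported trace form on the middle cohomology is non-degenerate (Poincaré duality on `X'`,
`BettiUniverse.nondegenerate_trCup_comp_pullEquiv`). [cite: HatcherAT2002, §3.3 Prop. 3.38] -/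
theorem transportedTraceForm_nondegenerate (hX' : IsSmoothProjective m X') (e : Y ≅ X') :
    (transportedTraceForm hX' e m).Nondegenerate :=
  BettiUniverse.nondegenerate_trCup_comp_pullEquiv hX' e

/-- **Even-degree cup products commute**: `a ∪ b = b ∪ a` on `Hᵏ(X(ℂ); ℚ)` for `k` even (graded
commutativity, sign `(−1)^{k·k} = 1`). [cite: HatcherAT2002, §3.2 Thm. 3.11] -/
theorem _root_.Literature.AlgebraicGeometry.HodgeTheory.BettiUniverse.cup_comm_of_even
    {X : SchemeOver ℂ} {k : ℕ} (hk : Even k) (a b : bettiCohomology X k) :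
    BettiUniverse.cup X k k a b = BettiUniverse.cup X k k b a := by
  have h := Motives.bettiCup_gradedComm
    (cupProduct_gradedComm_holds ℚ (Motives.ComplexPoints X)) (rfl : k + k = k + k) rfl a b
  have heven : Even (k * k) := hk.mul_right k
  rw [h, heven.neg_one_pow, one_smul]

/-- The transported trace form is symmetric in even degree. [cite: HatcherAT2002, §3.2 Thm. 3.11] -/
theorem transportedTraceForm_isSymm (hX' : IsSmoothProjective m X') (e : Y ≅ X') (hk : Even k) :
    (transportedTraceForm hX' e k).IsSymm := by
  refine ⟨fun x y ↦ ?_⟩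
  rw [transportedTraceForm_apply, transportedTraceForm_apply, BettiUniverse.cup_comm_of_even hk]

end Models

/-! ### §3 The universal family of cyclic covers of the plane and its monodromy (named fact) -/

section Family

/-- **The universal family of `p`-cyclic covers of `ℙ²` branched along smooth plane curves of degree
`p`, with its Picard–Lefschetz package** (hypothesis structure; Carlson–Toledo §2 with `k = d = p`,
`n = 1`, and §§3, 6, 7). DATA: a smooth projective family `u : 𝒴 ⟶ S` of surfaces over a smooth
irreducible quasi-projective `S` ("the universal family of cyclic covers `𝐘` […] has smooth fibers over
`Ũ = ℂ^{N+1} − Δ̃`": `S` is the open set of smooth members in the affine space of ternary forms of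
degree `p`), cohomologically locally trivial (Ehresmann: `R² u_* ℚ` is a local system on `S(ℂ)`); the
classifying map `pt` sending a ternary form `f` of degree `p` with `X_F` smooth, `F = x₃^p − f`, to its
point of `S(ℂ)` (values at other `f` are irrelevant), which presents `S(ℂ)` as the space of smooth
ternary `p`-forms: Zariski-closed subsets of `S(ℂ)` are cut out, on classified forms, by polynomials in
the coefficients (`exists_polynomials`), and every point is classified (`pt_surjective`);
isomorphisms `e_f : 𝒴_{pt f} ≅ X_F` of the fibres with the models (the fibre of (universalcyclic)
over `a` is `{y^p + f_a = 0}`); the covering automorphism `τ_f` of `H²(𝒴_{pt f}; ℚ)`, identified by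
`e_f` with `(σ_F)^*`, `σ_F = diagonalAut F _` the deck transformation `x₃ ↦ ζ_p x₃` of the model
(`pullEquiv_deck`); and, at every classified point, the Picard–Lefschetz package
`CyclicReflectionSystem` (§§3, 6, 7) for the monodromy group `Γ = ratMonodromyGroup u 2 _ (pt f)` of
`R² u_* ℚ`, the cup-product form (transported trace form of the model) and `τ_f`.
[cite: CarlsonToledo1999, §2, §3, §6 Proposition, §7 (held text p0004–p0007, p0013–p0016)] -/
structure CarlsonToledoFamily (p : ℕ) where
  /-- The total space `𝒴` of the universal family of cyclic covers. -/
  Y : SchemeOver ℂ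
  /-- The base `S`: smooth ternary forms of degree `p` (`Ũ = ℂ^{N+1} − Δ̃`). -/
  S : SchemeOver ℂ
  /-- The family `u : 𝒴 ⟶ S`, `(x, a) ↦ a`. -/
  u : Y ⟶ S
  /-- `u` is a smooth projective family of surfaces. -/
  isSmoothProjectiveFamily : IsSmoothProjectiveFamily u 2
  /-- `S` is quasi-projective (open in an affine space). -/
  isQuasiProjectiveOver : IsQuasiProjectiveOver S
  /-- The total space `𝒴 ⊂ Ũ × ℙ³` is quasi-projective (CT99 §2: "View the quotient `𝒴` in
  `(ℂ^{N+1} − {0}) × ℙ^{n+2}`"; here `k = d = p`, so the weighted projective space is `ℙ³`, and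
  `𝒴|Ũ` is closed in `Ũ × ℙ³`, open in `ℙ^{N+1} × ℙ³`). Needed by consumers that use the flat
  global polarization of `R² u_* ℚ` (e.g. `IsQuasiProjectiveOver` hypotheses of the tree's
  global-invariant-cycle / Hodge-locus facts). [cite: CarlsonToledo1999, §2 (held text p0004 L15–L26)] -/
  isQuasiProjectiveOver_total : IsQuasiProjectiveOver Y
  /-- `S` is smooth over `ℂ`. -/
  smooth : Smooth S.hom
  /-- `S` is irreducible (a non-empty open subset of an affine space). -/
  irreducibleSpace : IrreducibleSpace S.left
  /-- `R² u_* ℚ` is a local system on all of `S(ℂ)` (Ehresmann). -/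
  locallyTrivial : IsCohomologicallyLocallyTrivialOn u (Set.univ : Set (ComplexPoints S))
  /-- The classifying map: a smooth ternary `p`-form `f` ↦ the point of `S(ℂ)` carrying `X_F`. -/
  pt : MvPolynomial (Fin 3) ℂ → ComplexPoints S
  /-- Zariski-closed subsets of `S(ℂ)` are cut out, on classified forms, by polynomials in the
  coefficients `(f.coeff d)_{|d| = p}`. -/
  exists_polynomials : ∀ W : Set (ComplexPoints S), IsZariskiClosedOnPoints S W →
    ∃ G : Set (MvPolynomial {d : Fin 3 →₀ ℕ // d.degree = p} ℂ), ∀ f : MvPolynomial (Fin 3) ℂ,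
      f.IsHomogeneous p → f ≠ 0 → IsSmoothProjective 2 (SmoothHypersurface.hypersurface (cyclicCoverForm p f)) →
        (pt f ∈ W ↔ ∀ g ∈ G, MvPolynomial.eval (fun d : {d : Fin 3 →₀ ℕ // d.degree = p} => f.coeff d.1) g = 0)
  /-- Every point of `S(ℂ)` classifies a non-zero ternary `p`-form with smooth cyclic cover. -/
  pt_surjective : ∀ s : ComplexPoints S, ∃ f : MvPolynomial (Fin 3) ℂ, f.IsHomogeneous p ∧ f ≠ 0 ∧
    IsSmoothProjective 2 (SmoothHypersurface.hypersurface (cyclicCoverForm p f)) ∧ pt f = s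
  /-- The fibre over `pt f` is the model `X_F = V(x₃^p − f) ⊂ ℙ³`. -/
  iso : ∀ f : MvPolynomial (Fin 3) ℂ, f.IsHomogeneous p → f ≠ 0 →
    IsSmoothProjective 2 (SmoothHypersurface.hypersurface (cyclicCoverForm p f)) →
      (fiberOver u (pt f) ≅ SmoothHypersurface.hypersurface (cyclicCoverForm p f))
  /-- The covering automorphism on `H²(𝒴_{pt f}(ℂ); ℚ)` (the restriction of the cyclic automorphism
  `σ` of the universal family to the fibre). -/
  deck : ∀ f : MvPolynomial (Fin 3) ℂ, f.IsHomogeneous p → f ≠ 0 →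
    IsSmoothProjective 2 (SmoothHypersurface.hypersurface (cyclicCoverForm p f)) →
      (bettiCohomology (fiberOver u (pt f)) 2 ≃ₗ[ℚ] bettiCohomology (fiberOver u (pt f)) 2)
  /-- `e_f` identifies the covering automorphism with `(σ_F)^*`, `σ_F : x₃ ↦ ζ_p x₃` on the model:
  `φ (τ x) = σ_F^* (φ x)`, `φ = (e_f⁻¹)^*`. -/
  pullEquiv_deck : ∀ (f : MvPolynomial (Fin 3) ℂ) (hf : f.IsHomogeneous p) (hf0 : f ≠ 0)
    (hX : IsSmoothProjective 2 (SmoothHypersurface.hypersurface (cyclicCoverForm p f)))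
    (ha : deckUnit p ∈ diagonalStabilizer (cyclicCoverForm p f)) (x : bettiCohomology (fiberOver u (pt f)) 2),
    BettiUniverse.pullEquiv (iso f hf hf0 hX) 2 (deck f hf hf0 hX x) =
      BettiUniverse.pull (diagonalAut (cyclicCoverForm p f) ha) 2 (BettiUniverse.pullEquiv (iso f hf hf0 hX) 2 x)
  /-- §§3, 6, 7: the Picard–Lefschetz package at every classified point, for the monodromy group of
  `R² u_* ℚ`, the cup-product form and the covering automorphism. -/
  system : ∀ (f : MvPolynomial (Fin 3) ℂ) (hf : f.IsHomogeneous p) (hf0 : f ≠ 0)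
    (hX : IsSmoothProjective 2 (SmoothHypersurface.hypersurface (cyclicCoverForm p f))),
    CyclicReflectionSystem (ratMonodromyGroup u 2 locallyTrivial ⟨pt f, Set.mem_univ _⟩)
      (transportedTraceForm hX (iso f hf hf0 hX) 2) (deck f hf hf0 hX) p

/-- **Named fact (Carlson–Toledo 1999, §§2, 3, 6, 7, the case `n = 1`, `k = d = p`).** For every odd
`p ≥ 3` the universal family of `p`-cyclic covers of `ℙ²` branched along the smooth plane curves of
degree `p` exists with the properties recorded in `CarlsonToledoFamily p`: it is a smooth projective
family of surfaces, with quasi-projective total space `𝒴 ⊂ Ũ × ℙ³`, over the smooth irreducible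
quasi-projective space `Ũ` of smooth ternary `p`-forms (§2), its fibres are the models `X_F = V(x₃^p − f)` with their deck transformation, and at every point
the monodromy group of `R² u_* ℚ` is generated by the local monodromies of the meridians of the
(irreducible) discriminant (§3), each of which is the cyclic reflection — the covering automorphism on
the `(p−1)`-dimensional, non-degenerate, invariant-free vanishing space of an `A_{p−1}`-degeneration,
the identity on its orthogonal (§6, Proposition with `λ_i = (−1)^{n+1}ζ^i = ζ^i`) — the vanishing
spaces forming one orbit under the monodromy group and spanning the anti-invariant part of `H²`
(§7, last paragraph). [cite: CarlsonToledo1999, §2, §3, §6 Proposition, §7 last paragraph (held text p0004–p0007, p0013–p0016)] -/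
def nonempty_carlsonToledoFamily : Prop :=
  ∀ ⦃p : ℕ⦄, Odd p → 3 ≤ p → Nonempty (CarlsonToledoFamily p)

namespace CarlsonToledoFamily

variable {p : ℕ} (𝔉 : CarlsonToledoFamily p)

/-- The fibres of the family have finite-dimensional rational cohomology (they are smooth projective
surfaces). [cite: VoisinHodgeI2002, §7.1.1] -/
theorem finite (s : ComplexPoints 𝔉.S) (k : ℕ) : Module.Finite ℚ (bettiCohomology (fiberOver 𝔉.u s) k) :=
  BettiUniverse.finite (𝔉.isSmoothProjectiveFamily.isSmoothProjective s) k

/-- **The genericity clause (ALG) of the consumer**: a proper Zariski-closed subset `W ⊂ S(ℂ)` is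
avoided by every smooth member off ONE polynomial condition `G ≠ 0` on the coefficients, and `G`
does not vanish at some ternary `p`-form (so `{G ≠ 0}` is a dense open subset of the space of forms).
From `exists_polynomials` and `pt_surjective`: a point outside `W` is classified by some `f₀`, at
which one of the polynomials cutting out `W` does not vanish. [cite: CarlsonToledo1999, §2 (held text p0004)] -/
theorem alg (W : Set (ComplexPoints 𝔉.S)) (hW : IsZariskiClosedOnPoints 𝔉.S W) (hW' : W ≠ Set.univ) :
    ∃ G : MvPolynomial {d : Fin 3 →₀ ℕ // d.degree = p} ℂ,
      (∃ f : MvPolynomial (Fin 3) ℂ, f.IsHomogeneous p ∧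
        MvPolynomial.eval (fun d : {d : Fin 3 →₀ ℕ // d.degree = p} => f.coeff d.1) G ≠ 0) ∧
      ∀ f : MvPolynomial (Fin 3) ℂ, f.IsHomogeneous p →
        IsSmoothProjective 2 (SmoothHypersurface.hypersurface (cyclicCoverForm p f)) →
          MvPolynomial.eval (fun d : {d : Fin 3 →₀ ℕ // d.degree = p} => f.coeff d.1) G ≠ 0 → 𝔉.pt f ∉ W := by
  obtain ⟨𝒢, h𝒢⟩ := 𝔉.exists_polynomials W hW
  obtain ⟨s, hs⟩ := (Set.ne_univ_iff_exists_notMem W).mp hW'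
  obtain ⟨f₀, hf₀, hf₀0, hX₀, rfl⟩ := 𝔉.pt_surjective s
  have h : ¬ ∀ g ∈ 𝒢, MvPolynomial.eval (fun d : {d : Fin 3 →₀ ℕ // d.degree = p} => f₀.coeff d.1) g = 0 :=
    fun h ↦ hs ((h𝒢 f₀ hf₀ hf₀0 hX₀).mpr h)
  simp only [not_forall] at h
  obtain ⟨G, hG, hG0⟩ := h
  -- a coefficient of `f₀` which does not vanish, of degree `p`
  obtain ⟨d₀, hd₀⟩ := MvPolynomial.ne_zero_iff.mp hf₀0
  have hdeg : d₀.degree = p := by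
    rw [Finsupp.degree_eq_weight_one]
    exact hf₀ hd₀
  -- `G' = G · a_{d₀}` vanishes at `f = 0`, so the conclusion is automatic there
  refine ⟨G * MvPolynomial.X ⟨d₀, hdeg⟩, ⟨f₀, hf₀, ?_⟩, fun f hf hX hGf hmem ↦ ?_⟩
  · rw [map_mul, MvPolynomial.eval_X]
    exact mul_ne_zero hG0 hd₀
  · rw [map_mul, MvPolynomial.eval_X] at hGf
    have hf0 : f ≠ 0 := by
      rintro rfl
      exact hGf (by rw [MvPolynomial.coeff_zero, mul_zero])
    exact (left_ne_zero_of_mul hGf) ((h𝒢 f hf hf0 hX).mp hmem G hG)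

/-- The monodromy group at a classified point is generated by cyclic reflections along vanishing
vectors, pointwise form of the consumer's clause (P3) (unfolding `le_closure`).
[cite: CarlsonToledo1999, §3 (held text p0006)] -/
theorem ratMonodromyGroup_le_closure (f : MvPolynomial (Fin 3) ℂ) (hf : f.IsHomogeneous p) (hf0 : f ≠ 0)
    (hX : IsSmoothProjective 2 (SmoothHypersurface.hypersurface (cyclicCoverForm p f))) :
    ratMonodromyGroup 𝔉.u 2 𝔉.locallyTrivial ⟨𝔉.pt f, Set.mem_univ _⟩ ≤
      Subgroup.closure {r | ∃ δ ∈ (𝔉.system f hf hf0 hX).R,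
        (∀ x ∈ Submodule.span ℚ (Set.range fun i : ℕ => (𝔉.deck f hf hf0 hX ^ i) δ), r x = 𝔉.deck f hf hf0 hX x) ∧
        ∀ x, (∀ y ∈ Submodule.span ℚ (Set.range fun i : ℕ => (𝔉.deck f hf hf0 hX ^ i) δ),
          transportedTraceForm hX (𝔉.iso f hf hf0 hX) 2 x y = 0) → r x = x} :=
  (𝔉.system f hf hf0 hX).le_closure

/-! #### The transported deck: order, isometry, invariants; the consumer's envelope kit -/

section Kit

variable (f : MvPolynomial (Fin 3) ℂ) (hf : f.IsHomogeneous p) (hf0 : f ≠ 0)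
  (hX : IsSmoothProjective 2 (SmoothHypersurface.hypersurface (cyclicCoverForm p f)))
  (ha : deckUnit p ∈ diagonalStabilizer (cyclicCoverForm p f))

/-- `φ (τ^i x) = (σ_F^*)^i (φ x)`: the identification of the fibre with the model intertwines the
powers of the covering automorphism with the powers of the deck transformation.
[cite: CarlsonToledo1999, §2 (held text p0005)] -/
theorem pullEquiv_deck_pow (i : ℕ) (x : bettiCohomology (fiberOver 𝔉.u (𝔉.pt f)) 2) :
    BettiUniverse.pullEquiv (𝔉.iso f hf hf0 hX) 2 ((𝔉.deck f hf hf0 hX ^ i) x) =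
      (BettiUniverse.pull (diagonalAut (cyclicCoverForm p f) ha) 2 ^ i)
        (BettiUniverse.pullEquiv (𝔉.iso f hf hf0 hX) 2 x) := by
  induction i generalizing x with
  | zero => rw [pow_zero, pow_zero, Module.End.one_apply]; rfl
  | succ i ih =>
    rw [pow_succ, pow_succ, LinearEquiv.mul_apply, Module.End.mul_apply, ih, 𝔉.pullEquiv_deck f hf hf0 hX ha]

/-- **The covering automorphism has order dividing `p`** on `H²` of the fibre, granted
`(σ_F^*)^p = 1` on the model (clause (i) of the consumer's `Deck`). [cite: CarlsonToledo1999, §2 (held text p0005)] -/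
theorem deck_pow_eq_one (h1 : BettiUniverse.pull (diagonalAut (cyclicCoverForm p f) ha) 2 ^ p = 1) :
    𝔉.deck f hf hf0 hX ^ p = 1 := by
  refine LinearEquiv.ext fun x ↦ (BettiUniverse.pullEquiv (𝔉.iso f hf hf0 hX) 2).injective ?_
  rw [𝔉.pullEquiv_deck_pow f hf hf0 hX ha, h1, Module.End.one_apply]
  rfl

/-- **The covering automorphism preserves the cup-product form** of the fibre, granted `σ_F^*`
preserves `tr ∘ ∪` on the model (clause (ii) of the consumer's `Deck`): "automorphisms […] which
commute with the cyclic group of covering transformations (and which preserve […] the cup product)".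
[cite: CarlsonToledo1999, §2 (held text p0005)] -/
theorem transportedTraceForm_deck_deck
    (h2 : ∀ x y, BettiUniverse.tr hX (2 + 2) (BettiUniverse.cup _ 2 2
      (BettiUniverse.pull (diagonalAut (cyclicCoverForm p f) ha) 2 x)
      (BettiUniverse.pull (diagonalAut (cyclicCoverForm p f) ha) 2 y)) =
        BettiUniverse.tr hX (2 + 2) (BettiUniverse.cup _ 2 2 x y))
    (x y : bettiCohomology (fiberOver 𝔉.u (𝔉.pt f)) 2) :
    transportedTraceForm hX (𝔉.iso f hf hf0 hX) 2 (𝔉.deck f hf hf0 hX x) (𝔉.deck f hf hf0 hX y) =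
      transportedTraceForm hX (𝔉.iso f hf hf0 hX) 2 x y := by
  rw [transportedTraceForm_apply, transportedTraceForm_apply, 𝔉.pullEquiv_deck f hf hf0 hX ha,
    𝔉.pullEquiv_deck f hf hf0 hX ha, h2]

/-- The `τ`-invariants of the fibre correspond under `φ` to the `σ_F^*`-invariants of the model:
`φ(V^τ) = H²(X_F)^{σ}`. [cite: CarlsonToledo1999, §2 (held text p0005)] -/
theorem map_eigenspace_deck_one :
    (Module.End.eigenspace (𝔉.deck f hf hf0 hX : bettiCohomology (fiberOver 𝔉.u (𝔉.pt f)) 2 →ₗ[ℚ]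
        bettiCohomology (fiberOver 𝔉.u (𝔉.pt f)) 2) 1).map
      (BettiUniverse.pullEquiv (𝔉.iso f hf hf0 hX) 2 : bettiCohomology (fiberOver 𝔉.u (𝔉.pt f)) 2 →ₗ[ℚ]
        bettiCohomology (SmoothHypersurface.hypersurface (cyclicCoverForm p f)) 2) =
      Module.End.eigenspace (BettiUniverse.pull (diagonalAut (cyclicCoverForm p f) ha) 2) 1 := by
  ext y
  simp only [Submodule.mem_map, Module.End.mem_eigenspace_iff, one_smul, LinearEquiv.coe_coe]
  constructor
  · rintro ⟨x, hx, rfl⟩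
    rw [← 𝔉.pullEquiv_deck f hf hf0 hX ha]
    exact congrArg _ hx
  · intro hy
    refine ⟨(BettiUniverse.pullEquiv (𝔉.iso f hf hf0 hX) 2).symm y, ?_, LinearEquiv.apply_symm_apply _ y⟩
    apply (BettiUniverse.pullEquiv (𝔉.iso f hf hf0 hX) 2).injective
    change BettiUniverse.pullEquiv (𝔉.iso f hf hf0 hX) 2 (𝔉.deck f hf hf0 hX _) = _
    rw [𝔉.pullEquiv_deck f hf hf0 hX ha, LinearEquiv.apply_symm_apply, hy]

/-- **The invariant line transports**: `dim V^τ = dim H²(X_F; ℚ)^{σ}` (so clause (iii) of the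
consumer's `Deck`, `dim H²(X_F)^{σ} = 1`, gives `dim V^τ = 1`). [cite: CarlsonToledo1999, §2 (held text p0005)] -/
theorem finrank_eigenspace_deck_one :
    Module.finrank ℚ ↥(Module.End.eigenspace (𝔉.deck f hf hf0 hX :
        bettiCohomology (fiberOver 𝔉.u (𝔉.pt f)) 2 →ₗ[ℚ] bettiCohomology (fiberOver 𝔉.u (𝔉.pt f)) 2) 1) =
      Module.finrank ℚ ↥(Module.End.eigenspace
        (BettiUniverse.pull (diagonalAut (cyclicCoverForm p f) ha) 2) 1) := by
  rw [← 𝔉.map_eigenspace_deck_one f hf hf0 hX ha, LinearEquiv.finrank_map_eq]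

include hf hf0 in
/-- **The consumer's envelope kit** (clause MEM of `stub_cyclicPencilEnvelope`, line
`unitary-reflection-zariski` of crux `VeryGeneralDeckCommutatorsInHg`, in its quantifier order, for a
NON-ZERO classified form). Given the family `𝔉`, a non-zero ternary `p`-form `f` with `X_F` smooth,
the clauses (i)–(iii) of the model's `Deck` (`(σ_F^*)^p = 1`, `σ_F^*` a `tr ∘ ∪`-isometry,
`dim H²(X_F)^{σ} ≤ 1`) and any Hodge-symmetric Hodge model `A` of the fibre: there are
`φ = (e_f⁻¹)^*`, the transported trace form `B`, the covering automorphism `τ` and the vanishing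
vectors `R` with (COMPAT) `B` `τ`-invariant, `φ τ = σ_F^* φ`, `B = φ^*(tr ∘ ∪)`; (HG) `φ(·)φ⁻¹`
carries `Hg(A; H²(fibre))` into `Hg(H²(X_F))` (`BettiUniverse.mem_hodgeGroup_of_iso_of_hodgeModel`);
`dim V^τ ≤ 1`; and the Picard–Lefschetz clauses P1–P5 of the `CyclicReflectionSystem` at `pt f`,
unfolded. The Hodge-theoretic inputs `hHD`, `hI` are the light-form hypotheses of `BettiUniverseAxioms`
(discharged in the tree by `exists_isReal_hodgeModel_holds`, `hodgePQ_independent_of_hodgeModel_holds`).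
[cite: CarlsonToledo1999, §2, §3, §6 Proposition, §7 (held text p0004–p0007, p0013–p0016)] -/
theorem exists_envelopeKit [Motives.HodgeTensorFacts.{0, 0}] (hHD : exists_isReal_hodgeModel)
    (hI : hodgePQ_independent_of_hodgeModel)
    (h1 : BettiUniverse.pull (diagonalAut (cyclicCoverForm p f) ha) 2 ^ p = 1)
    (h2 : ∀ x y, BettiUniverse.tr hX (2 + 2) (BettiUniverse.cup _ 2 2
      (BettiUniverse.pull (diagonalAut (cyclicCoverForm p f) ha) 2 x)
      (BettiUniverse.pull (diagonalAut (cyclicCoverForm p f) ha) 2 y)) =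
        BettiUniverse.tr hX (2 + 2) (BettiUniverse.cup _ 2 2 x y))
    (h3 : Module.finrank ℚ ↥(Module.End.eigenspace
      (BettiUniverse.pull (diagonalAut (cyclicCoverForm p f) ha) 2) 1) ≤ 1)
    (A : HodgeModel 2 (fiberOver 𝔉.u (𝔉.pt f))) (hA : A.IsHodgeSymmetric)
    [Module.Finite ℚ (bettiCohomology (fiberOver 𝔉.u (𝔉.pt f)) 2)] :
    ∃ (φ : bettiCohomology (fiberOver 𝔉.u (𝔉.pt f)) 2 ≃ₗ[ℚ]
        bettiCohomology (SmoothHypersurface.hypersurface (cyclicCoverForm p f)) 2)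
      (B : LinearMap.BilinForm ℚ (bettiCohomology (fiberOver 𝔉.u (𝔉.pt f)) 2)) (_ : B.IsSymm)
      (_ : B.Nondegenerate)
      (τ : bettiCohomology (fiberOver 𝔉.u (𝔉.pt f)) 2 ≃ₗ[ℚ] bettiCohomology (fiberOver 𝔉.u (𝔉.pt f)) 2)
      (_ : τ ^ p = 1) (R : Set (bettiCohomology (fiberOver 𝔉.u (𝔉.pt f)) 2)),
      (∀ x y, B (τ x) (τ y) = B x y) ∧
      (∀ x, φ (τ x) = BettiUniverse.pull (diagonalAut (cyclicCoverForm p f) ha) 2 (φ x)) ∧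
      (∀ x y, B x y = BettiUniverse.tr hX (2 + 2) (BettiUniverse.cup _ 2 2 (φ x) (φ y))) ∧
      (haveI := BettiUniverse.finite hX 2
        ∀ k : bettiCohomology (fiberOver 𝔉.u (𝔉.pt f)) 2 ≃ₗ[ℚ] bettiCohomology (fiberOver 𝔉.u (𝔉.pt f)) 2,
          k ∈ (A.hodgeStructure (𝔉.isSmoothProjectiveFamily.isSmoothProjective (𝔉.pt f)) hA 2).hodgeGroup →
            (φ.symm.trans k).trans φ ∈ (BettiUniverse.hodge hHD hX 2).hodgeGroup) ∧
      Module.finrank ℚ ↥(Module.End.eigenspace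
        (τ : bettiCohomology (fiberOver 𝔉.u (𝔉.pt f)) 2 →ₗ[ℚ] bettiCohomology (fiberOver 𝔉.u (𝔉.pt f)) 2) 1) ≤ 1 ∧
      (∀ δ ∈ R, δ ≠ 0 ∧ (∑ i ∈ Finset.range p, (τ ^ i) δ) = 0 ∧
        ∀ x ∈ Submodule.span ℚ (Set.range fun i : ℕ => (τ ^ i) δ),
          (∀ y ∈ Submodule.span ℚ (Set.range fun i : ℕ => (τ ^ i) δ), B x y = 0) → x = 0) ∧
      (∀ δ ∈ R, ∃ r ∈ ratMonodromyGroup 𝔉.u 2 𝔉.locallyTrivial ⟨𝔉.pt f, Set.mem_univ _⟩,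
        (∀ x ∈ Submodule.span ℚ (Set.range fun i : ℕ => (τ ^ i) δ), r x = τ x) ∧
          ∀ x, (∀ y ∈ Submodule.span ℚ (Set.range fun i : ℕ => (τ ^ i) δ), B x y = 0) → r x = x) ∧
      (ratMonodromyGroup 𝔉.u 2 𝔉.locallyTrivial ⟨𝔉.pt f, Set.mem_univ _⟩ ≤ Subgroup.closure {r | ∃ δ ∈ R,
        (∀ x ∈ Submodule.span ℚ (Set.range fun i : ℕ => (τ ^ i) δ), r x = τ x) ∧
          ∀ x, (∀ y ∈ Submodule.span ℚ (Set.range fun i : ℕ => (τ ^ i) δ), B x y = 0) → r x = x}) ∧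
      (∀ δ ∈ R, ∀ δ' ∈ R, ∃ γ ∈ ratMonodromyGroup 𝔉.u 2 𝔉.locallyTrivial ⟨𝔉.pt f, Set.mem_univ _⟩,
        γ δ' ∈ Submodule.span ℚ (Set.range fun i : ℕ => (τ ^ i) δ)) ∧
      (∀ x, (∑ i ∈ Finset.range p, (τ ^ i) x) = 0 →
        x ∈ Submodule.span ℚ {y | ∃ δ ∈ R, ∃ i : ℕ, y = (τ ^ i) δ}) := by
  set S := 𝔉.system f hf hf0 hX with hS
  refine ⟨BettiUniverse.pullEquiv (𝔉.iso f hf hf0 hX) 2, transportedTraceForm hX (𝔉.iso f hf hf0 hX) 2,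
    transportedTraceForm_isSymm hX _ even_two, transportedTraceForm_nondegenerate hX _, 𝔉.deck f hf hf0 hX,
    𝔉.deck_pow_eq_one f hf hf0 hX ha h1, S.R, 𝔉.transportedTraceForm_deck_deck f hf hf0 hX ha h2,
    𝔉.pullEquiv_deck f hf hf0 hX ha, fun x y ↦ rfl,
    fun k hk ↦ BettiUniverse.mem_hodgeGroup_of_iso_of_hodgeModel hHD hI
      (𝔉.isSmoothProjectiveFamily.isSmoothProjective (𝔉.pt f)) hX (𝔉.iso f hf hf0 hX) A hA 2 k hk,
    (𝔉.finrank_eigenspace_deck_one f hf hf0 hX ha).le.trans h3,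
    fun δ hδ ↦ ⟨S.ne_zero δ hδ, S.sum_pow_apply_eq_zero δ hδ, S.eq_zero_of_forall_apply_eq_zero δ hδ⟩,
    S.exists_mem_isCyclicReflection, S.le_closure, fun δ hδ δ' hδ' ↦ S.exists_apply_mem_cyclicSpan hδ hδ',
    S.mem_span_of_sum_pow_apply_eq_zero⟩

end Kit

end CarlsonToledoFamily

end Family

end HodgeTheory

end Literature.AlgebraicGeometry.HodgeTheory

end
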